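import Summits.BirchSwinnertonDyer.BirchSwinnertonDyer.Theorems.UniversalToricDescentSigmaCoinvariantsAnyTorsion
import HarnessLib

/-!
# Route UniversalToricDescent — `(conj_γ − 1)` is onto the RELAXED anticyclotomic Selmer group
# `Sel^{Σ}_{rel}(K_∞, E[p^∞])` (away conditions off `Σ`, NO condition above `p`), without (iv)

Lead prover bsd-wall-utd-p1 g13 (`--supports` ♭T′ stmt-BirchSwinnertonDyer-26975; step (β1) of the (L)-free residual comparison
(M1) of stub B′ `stub_lambdaTransportPT`, memo RESIDUE-B-PRIME-utdp1g13 §3). The (L)-free count of `#Sel_𝔭^Σ(K_∞, E[p^∞])[p]` needs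
the surjectivity of the signature map at the STRICT place `𝔭 ∣ p` on the group `G_rel^Σ` of classes of `H¹(K_∞, E[p^∞])`
satisfying the away conditions off `Σ` and NOTHING above `p` (kernel `Sel_𝔭^Σ`, `Λ`-corank 2 = that of `⊕_{w∣𝔭} H¹(K_{∞,w}, E[p^∞])`).
In the tree `G_rel^Σ = selmerAc W p κ v₀ Σ` for ANY place `v₀ ∤ p`, `v₀ ∉ Σ` used as a FAKE strict place: the clauses of
`mem_selmerOver_iff_awayKer` constrain the primes above `p` only through the strict-place parameter, and for `v₀ ∉ Σ` the third
clause (away at `v₀`) is already part of the first. The engine of the surjectivity needs `φ = conj_γ − 1` ONTO the source: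

* `surjective_conjSelmerAc_sub_one_relaxed_anyTorsion` — hypotheses of `surjective_conjSelmerAc_sub_one_of_subsingleton_anyTorsion`
  (`K` totally complex; Poitou–Tate; Milne I 2.8; `𝔭 ≠ 𝔮` above `p`; killing exponent at `𝔮`; `Sel_𝔮(K, E[p^∞])` finite;
  `H²(K, E[p^∞]) = 0`; `γ`), a set `Σ`, a place `v₀ ∤ p`, `v₀ ∉ Σ` ⟹ `conj_γ − 1` is onto `selmerAc W p κ v₀ Σ`. Proof = the (L10)
  proof with the local lift at `𝔭` DROPPED (the Poitou–Tate surgery prescribes `0` at `𝔭`; the corrected class is away-trivial off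
  `Σ` and unconstrained above `p`).
* `surjective_conjSelmerAc_sub_one_relaxed_baseChange_anyTorsion` — the route's instance (`E/ℚ`, `K` imaginary quadratic, `p` split,
  Poitou–Tate ×2, `Sel_v(K, E[p^∞]) < ∞` at both `v ∣ p`).

HONEST STATUS: helper theorems, CONDITIONAL on the cited Poitou–Tate facts; the strict-place surjectivity (β2), the count and the twin's
local tower torsion finiteness remain. THEOREMS ONLY; no definition, no named fact, no `sorry`. BSD is not advanced by this file.
References: [JetchevSkinnerWan2017] Lemma 3.3.3, Prop. 3.3.2 (arXiv:1512.06894 pp. 11–12); [GreenbergVatsal2000] §2 Prop. (2.1);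
[MilneADT2006] I 2.8, 4.10.
-/

set_option autoImplicit false
-- `…BirchSwinnertonDyer.BirchSwinnertonDyer.Theorems…` is the problem's mandated namespace (D-0017).
set_option linter.dupNamespace false

noncomputable section

open scoped Classical

namespace Summit.BirchSwinnertonDyer.BirchSwinnertonDyer.Theorems.UniversalToricDescentSigmaCoinvariants

open CategoryTheory Function Field NumberField IsDedekindDomain WeierstrassCurve
open Literature.NumberTheory.GaloisRepresentations Literature.NumberTheory.EllipticCurves
  Literature.NumberTheory.EllipticCurves.GreenbergSelmer Literature.NumberTheory.GaloisCohomology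
  Literature.NumberTheory.EllipticCurves.IwasawaAlgebra Literature.NumberTheory.EllipticCurves.Rank1Residual
  Summit.BirchSwinnertonDyer.Rank1Residual Summit.BirchSwinnertonDyer.Rank1Residual.X11b
  Summit.BirchSwinnertonDyer.Rank1Residual.X11b.Coinv Summit.BirchSwinnertonDyer.Rank1Residual.X11b.LocBridge
  Summit.BirchSwinnertonDyer.Rank1Residual.X11b.AcSelmer Summit.BirchSwinnertonDyer.Rank1Residual.X11b.H2Support
  Summit.BirchSwinnertonDyer.Rank1Residual.X11b.Levels Summit.BirchSwinnertonDyer.Rank1Residual.Iwasawa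
  Summit.BirchSwinnertonDyer.BirchSwinnertonDyer.Theorems.UniversalToricDescentNoFiniteSubmodule
  Summit.BirchSwinnertonDyer.BirchSwinnertonDyer.Theorems.UniversalToricDescentStrictPlace
  Summit.BirchSwinnertonDyer.BirchSwinnertonDyer.Theorems.SchneiderFreeAdditiveX3
open Summit.BirchSwinnertonDyer.Rank1Residual.X11b.ProcyclicDescent (kerK)

/-! ### §1 `(conj_γ − 1)` onto `selmerAc W p κ v₀ Σ` for a fake strict place `v₀ ∤ p`, `v₀ ∉ Σ` -/

section Relaxed

variable {K : Type} [Field K] [NumberField K] (W : WeierstrassCurve K) [W.IsElliptic] (p : ℕ)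
  [Fact p.Prime] (κ : ZpExtension K p)

-- adapted from `surjective_conjSelmerAc_sub_one_of_subsingleton_anyTorsion` (this namespace, g13): no local lift above `p`.
/-- **`conj_γ − 1` is ONTO the relaxed group `G_rel^Σ = selmerAc W p κ v₀ Σ`** (`v₀ ∤ p`, `v₀ ∉ Σ` a fake strict place: away
conditions off `Σ`, nothing above `p`). Hypotheses: `K` totally complex; Poitou–Tate for `K`, Milne I 2.8 at the completions;
`𝔭 ≠ 𝔮` above `p`; a killing exponent `p^m` of `E(K̄)[p^∞]^{D_𝔮}`; `Sel_𝔮(K, E[p^∞])` finite; `H²(K, E[p^∞]) = 0`; `γ` a topological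
generator. Steps: `y₀` with `conj_γ y₀ − y₀ = x`; local lifts at the away places off `Σ`; Poitou–Tate surgery
(`levelLiftingP_of_finite_anyTorsion`, prescribing `0` at `𝔭`); `y = y₀ − res g`.
[cite: JetchevSkinnerWan2017, Lemma 3.3.3 and Prop. 3.3.2 (arXiv:1512.06894 pp. 11–12)] [cite: GreenbergVatsal2000, §2 Prop. (2.1) (pp. 23–24)] -/
theorem surjective_conjSelmerAc_sub_one_relaxed_anyTorsion [IsTotallyComplex K]
    (hPT : poitouTate_selmerStructure_duality K)
    (hEP : ∀ v : HeightOneSpectrum (𝓞 K), localEulerPoincareCharacteristic (v.adicCompletion K))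
    {𝔭 𝔮 : HeightOneSpectrum (𝓞 K)} (h𝔭 : ((p : ℕ) : 𝓞 K) ∈ 𝔭.asIdeal)
    (h𝔮 : ((p : ℕ) : 𝓞 K) ∈ 𝔮.asIdeal) (hne : 𝔮 ≠ 𝔭)
    {m : ℕ} (htor𝔮 : ∀ Q : W.geomPrimaryTorsion p, (∀ d ∈ decomp 𝔮, d • Q = Q) → p ^ m • Q = 0)
    (hfin : Finite (selmerAcBase W p 𝔮 ∅))
    (h2 : Subsingleton (galoisCohomology (primaryGaloisModule W p) 2))
    {γ : absoluteGaloisGroup K} (hγ : κ.IsTopGenerator γ) (S : Set (HeightOneSpectrum (𝓞 K)))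
    {v₀ : HeightOneSpectrum (𝓞 K)} (hv₀ : ((p : ℕ) : 𝓞 K) ∉ v₀.asIdeal) (hv₀S : v₀ ∉ S) :
    Function.Surjective
      ((conjSelmerAc W p κ v₀ S γ - 1 : AddMonoid.End (selmerAc W p κ v₀ S)) :
        selmerAc W p κ v₀ S → selmerAc W p κ v₀ S) := by
  intro x
  have hM : ∀ m : W.geomPrimaryTorsion p, IsOpen {σ : absoluteGaloisGroup K | σ • m = m} :=
    isOpen_stabilizer_geomPrimaryTorsion W p
  -- (1) `y₀` with `conj_γ y₀ - y₀ = x`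
  obtain ⟨y₀, hy₀⟩ :=
    exists_conjH1_sub_eq_of_subsingleton W p κ h2 hγ (x : W.subgroupH1 p κ.kerSubgroup)
  -- (2) all conjugates of `y₀` agree with `y₀` modulo `Sel^Σ`
  have hSel : ∀ g : absoluteGaloisGroup K,
      W.conjH1 p κ.kerSubgroup g y₀ - y₀ ∈ selmerAc W p κ v₀ S :=
    conjH1_sub_mem_selmerAc_of_isTopGenerator hγ (by rw [hy₀]; exact x.2)
  -- the cocycle of `y₀` and its zero set
  obtain ⟨φ, hφ⟩ := oneCocycleClass_surjective _ y₀
  obtain ⟨N₁, hN₁⟩ := exists_openNormalSubgroup_forall_apply_eq_zero (K := K) φ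
  -- the exceptional set `Σ'` (finite, away from `p`)
  set S' : Set (HeightOneSpectrum (𝓞 K)) := {v | ((p : ℕ) : 𝓞 K) ∉ v.asIdeal ∧
    (¬ W.HasGoodReductionAt v ∨
      ¬ (adicCompletionPrime K v).inertia (absoluteGaloisGroup K) ≤ (N₁ : Subgroup _))} with hS'
  have hS'fin : S'.Finite := finite_exceptional W p N₁
  have hSp : ∀ v ∈ S', ((p : ℕ) : 𝓞 K) ∉ v.asIdeal := fun v hv ↦ hv.1
  -- (3) the local lifts, at the places OFF `Σ` ONLY (no lift at the primes above `p`)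
  have hz : ∀ v : HeightOneSpectrum (𝓞 K), (((p : ℕ) : 𝓞 K) ∉ v.asIdeal ∧ v ∉ S) →
      ∃ z : subgroupH1 (decomp (K := K) v) (W.geomPrimaryTorsion p),
        ResKernel.resSubgroup (kerD κ v) (W.geomPrimaryTorsion p) z =
          resKerD κ (W.geomPrimaryTorsion p) v y₀ := fun v hv ↦
    exists_resSubgroup_kerD_eq v (Or.inl hv) hSel
  choose z hz using hz
  -- at the good unramified `v ∉ Σ' ∪ Σ`, `v ∤ p`: `Ψ_v = 0` and `y₀` is locally trivial
  have hzero : ∀ (v : HeightOneSpectrum (𝓞 K)) (hpv : ((p : ℕ) : 𝓞 K) ∉ v.asIdeal) (hvS0 : v ∉ S),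
      v ∉ S' → resKerD κ (W.geomPrimaryTorsion p) v y₀ = 0 := by
    intro v hpv hvS0 hvS
    have hgood : W.HasGoodReductionAt v := by
      by_contra h; exact hvS ⟨hpv, Or.inl h⟩
    have hI : (adicCompletionPrime K v).inertia (absoluteGaloisGroup K) ≤ (N₁ : Subgroup _) := by
      by_contra h; exact hvS ⟨hpv, Or.inr h⟩
    have h := hz v ⟨hpv, hvS0⟩
    rw [← hφ] at h ⊢
    exact (eq_zero_of_inertia_le hpv hgood φ hN₁ hI (z v ⟨hpv, hvS0⟩) h).2
  -- the finite set `T` of places: `∞ ∪ {v ∣ p} ∪ Σ'`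
  have hp0 : p ≠ 0 := (Fact.out : p.Prime).ne_zero
  set T : Finset (Place K) := (Finset.univ.image Sum.inl) ∪
    (((finite_setOf_natCast_mem (K := K) p hp0).toFinset ∪ hS'fin.toFinset).image Sum.inr) with hT
  have hinf : ∀ w : InfinitePlace K, (Sum.inl w : Place K) ∈ T := fun w ↦
    Finset.mem_union_left _ (Finset.mem_image_of_mem _ (Finset.mem_univ w))
  have hpT : ∀ v : HeightOneSpectrum (𝓞 K), ((p : ℕ) : 𝓞 K) ∈ v.asIdeal →
      (Sum.inr v : Place K) ∈ T := fun v hv ↦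
    Finset.mem_union_right _ (Finset.mem_image_of_mem _
      (Finset.mem_union_left _ ((Set.Finite.mem_toFinset _).mpr hv)))
  have hSig : ∀ v ∈ S', (Sum.inr v : Place K) ∈ T := fun v hv ↦
    Finset.mem_union_right _ (Finset.mem_image_of_mem _
      (Finset.mem_union_right _ ((Set.Finite.mem_toFinset _).mpr hv)))
  have hbad : ∀ v : HeightOneSpectrum (𝓞 K), ¬ W.HasGoodReductionAt v →
      (Sum.inr v : Place K) ∈ T := by
    intro v hv
    by_cases hpv : ((p : ℕ) : 𝓞 K) ∈ v.asIdeal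
    · exact hpT v hpv
    · exact hSig v ⟨hpv, Or.inl hv⟩
  have hRfin : {v : HeightOneSpectrum (𝓞 K) | (Sum.inr v : Place K) ∈ T ∧
      ((p : ℕ) : 𝓞 K) ∉ v.asIdeal}.Finite :=
    (T.finite_toSet.preimage Sum.inr_injective.injOn).subset fun v hv ↦ hv.1
  have hfinR := finite_relaxed W p (𝔮 := 𝔮) hEP hfin hRfin (fun v hv ↦ hv.2)
  -- the family of local classes on `Σ'⁺ = Σ' ∪ {𝔭}`: the lifts off `Σ`, ZERO at `𝔭` and on `Σ`
  let τ : ∀ v : (insert 𝔭 S' : Set (HeightOneSpectrum (𝓞 K))),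
      galoisCohomology
        ((primaryGaloisModule W p).toLocal (Sum.inr (v : HeightOneSpectrum (𝓞 K)))) 1 :=
    fun v ↦
      if h : (((p : ℕ) : 𝓞 K) ∉ (v : HeightOneSpectrum (𝓞 K)).asIdeal ∧
          (v : HeightOneSpectrum (𝓞 K)) ∉ S) then
        inflDecomp hM (v : HeightOneSpectrum (𝓞 K)) (z v h)
      else 0
  obtain ⟨K₀, hK₀⟩ := exists_pow_nsmul_family_eq_zero (hS'fin.insert 𝔭) τ
  -- (4) Poitou–Tate surgery
  obtain ⟨N, xN, hxN, hloc⟩ := SchneiderFreeAdditiveX3.levelLiftingP_of_finite_anyTorsion W p 𝔭 S' T hPT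
    (fun w ↦ IsTotallyComplex.isComplex w) h𝔭 h𝔮 hne hSp hinf hpT hSig hbad hfinR htor𝔮 K₀ τ hK₀
  set g : galoisCohomology (primaryGaloisModule W p) 1 :=
    galoisCohomology.map (Levels.primaryInclusion W p N) 1 xN with hg
  -- (5) the corrected class
  set y : W.subgroupH1 p κ.kerSubgroup :=
    y₀ - ResKernel.resSubgroup κ.kerSubgroup (W.geomPrimaryTorsion p) (toDiscreteH1 hM g) with hy
  have hconj : ∀ σ : absoluteGaloisGroup K, W.conjH1 p κ.kerSubgroup σ y =
      y + (W.conjH1 p κ.kerSubgroup σ y₀ - y₀) := by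
    intro σ
    rw [hy, map_sub, conjH1_resSubgroup]
    abel
  -- the local computation of `y`
  have hresy : ∀ (v : HeightOneSpectrum (𝓞 K)), resKerD κ (W.geomPrimaryTorsion p) v y =
      resKerD κ (W.geomPrimaryTorsion p) v y₀ -
        ResKernel.resSubgroup (kerD κ v) (W.geomPrimaryTorsion p)
          (ResKernel.resSubgroup (decomp v) (W.geomPrimaryTorsion p) (toDiscreteH1 hM g)) := by
    intro v
    rw [hy, map_sub, resKerD_resSubgroup]
  have haway : ∀ (v : HeightOneSpectrum (𝓞 K))
      (hv : ((p : ℕ) : 𝓞 K) ∉ v.asIdeal ∧ v ∉ S),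
      y ∈ awayKer κ.kerSubgroup (W.geomPrimaryTorsion p) v := by
    intro v hv
    rw [mem_awayKer_iff_resKerD_eq_zero, hresy]
    by_cases hvI : v ∈ insert 𝔭 S'
    · -- prescribed place: `loc_v g = infl Ψ_v`
      have hl := hloc ⟨v, hvI⟩
      have hτ : τ ⟨v, hvI⟩ = inflDecomp hM v (z v hv) := dif_pos hv
      rw [hτ] at hl
      have e : ResKernel.resSubgroup (decomp v) (W.geomPrimaryTorsion p) (toDiscreteH1 hM g) =
          z v hv :=
        resSubgroup_decomp_eq_of_localization_eq hM v g _ hl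
      rw [e, hz, sub_self]
    · -- other place away from `p`: `loc_v g = 0` and `y₀` locally trivial
      have hpvS0 : ((p : ℕ) : 𝓞 K) ∉ v.asIdeal ∧ v ∉ S := hv
      have hvS : v ∉ S' := fun h ↦ hvI (Set.mem_insert_of_mem _ h)
      have h0 : galoisCohomology.localization (primaryGaloisModule W p) (Sum.inr v) 1 g = 0 :=
        localization_map_primaryInclusion_eq_zero_of_mem_upperStructureP W p N 𝔭 S' hxN h𝔭 hpvS0.1
          hvS
      rw [resSubgroup_decomp_eq_zero_of_localization_eq_zero hM v g h0, map_zero, sub_zero]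
      exact hzero v hpvS0.1 hpvS0.2 hvS
  have hySel : y ∈ selmerAc W p κ v₀ S := by
    change y ∈ selmerOver κ.kerSubgroup (W.geomPrimaryTorsion p) p v₀ S
    rw [mem_selmerOver_iff_awayKer]
    refine ⟨fun v hpv hvS0 σ ↦ ?_, fun w σ ↦ ?_, fun σ ↦ ?_⟩
    · rw [hconj]
      exact add_mem (haway v ⟨hpv, hvS0⟩) ((mem_awayKer_iff_resKerD_eq_zero κ v _).2
        (resKerD_eq_zero_of_mem_selmerAc (Or.inl ⟨hpv, hvS0⟩) (hSel σ)))
    · exact mem_infKer_of_decompInf_eq_bot w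
        (decompInf_eq_bot_of_isComplex (IsTotallyComplex.isComplex w)) _
    · rw [hconj]
      exact add_mem (haway v₀ ⟨hv₀, hv₀S⟩) ((mem_awayKer_iff_resKerD_eq_zero κ v₀ _).2
        (resKerD_eq_zero_of_mem_selmerAc (Or.inl ⟨hv₀, hv₀S⟩) (hSel σ)))
  refine ⟨⟨y, hySel⟩, Subtype.ext ?_⟩
  change W.conjH1 p κ.kerSubgroup γ y - y = (x : W.subgroupH1 p κ.kerSubgroup)
  rw [hconj, hy₀]
  abel


end Relaxed

/-! ### §2 The route's instance -/

section Route

variable (W : WeierstrassCurve ℚ) [W.IsElliptic] [W.IsGloballyMinimal] (p : ℕ) [Fact p.Prime]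
  {K : Type} [Field K] [NumberField K]

/-- **`conj_γ − 1` onto `G_rel^Σ(K_∞, E_K[p^∞]) = selmerAc (W.baseChange K) p κ v₀ Σ`** for `E/ℚ`, `K` imaginary quadratic with `p`
split, ANY `ℤ_p`-extension with topological generator, ANY `Σ` and fake strict place `v₀ ∤ p`, `v₀ ∉ Σ`, from Poitou–Tate ×2 and
`Sel_v(K, E[p^∞]) < ∞` at both `v ∣ p` (the surgery runs at a given `𝔭 ∣ p` with its conjugate `𝔮`).
[cite: JetchevSkinnerWan2017, Lemma 3.3.3 (arXiv:1512.06894 pp. 11–12)] [cite: MilneADT2006, Ch. I, Thm. 4.10 and Thm. 2.8] -/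
theorem surjective_conjSelmerAc_sub_one_relaxed_baseChange_anyTorsion
    (hPT : poitouTate_selmerStructure_duality K) (hPT2 : poitouTate_sha_tateDual K)
    (hK : IsImaginaryQuadratic K) (hsplit : SplitsIn K p)
    (κ : ZpExtension K p) {γ : absoluteGaloisGroup K} (hγ : κ.IsTopGenerator γ)
    {𝔭 : HeightOneSpectrum (𝓞 K)} (h𝔭 : ((p : ℕ) : 𝓞 K) ∈ 𝔭.asIdeal)
    (hfin : ∀ v : HeightOneSpectrum (𝓞 K), ((p : ℕ) : 𝓞 K) ∈ v.asIdeal →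
      Finite (selmerAcBase (W.baseChange K) p v ∅))
    (S : Set (HeightOneSpectrum (𝓞 K))) {v₀ : HeightOneSpectrum (𝓞 K)} (hv₀ : ((p : ℕ) : 𝓞 K) ∉ v₀.asIdeal)
    (hv₀S : v₀ ∉ S) :
    Function.Surjective
      ((conjSelmerAc (W.baseChange K) p κ v₀ S γ - 1 : AddMonoid.End (selmerAc (W.baseChange K) p κ v₀ S)) :
        selmerAc (W.baseChange K) p κ v₀ S → selmerAc (W.baseChange K) p κ v₀ S) := by
  haveI : IsTotallyComplex K := hK.2
  haveI hEK : (W.baseChange K).IsElliptic := by rw [WeierstrassCurve.baseChange]; infer_instance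
  obtain ⟨σ, 𝔮, -, hne, h𝔮, -⟩ :=
    LocalIndexTransport.exists_conj_prime_of_splitsIn K p hK.1 hsplit h𝔭
  have htor := exists_pow_nsmul_local_eq_zero W p hK.1 hsplit
  haveI := hfin 𝔭 h𝔭
  have h2 := subsingleton_galoisCohomology_two_primary_anyTorsion (W.baseChange K) p 𝔭 ∅ hPT2
    (fieldCdLE_two_of_isTotallyComplex fieldCdLE_two_of_numberField_holds K p) htor
  obtain ⟨he𝔮, hf𝔮⟩ := degreeOne_of_splitsIn hK.1 hsplit h𝔮
  obtain ⟨m, hm⟩ := exists_pow_nsmul_fixedPoints_decomp_eq_zero W p 𝔮 h𝔮 he𝔮 hf𝔮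
  exact surjective_conjSelmerAc_sub_one_relaxed_anyTorsion (W.baseChange K) p κ hPT
    (fun v ↦ GaloisImage.EP.localEulerPoincareCharacteristic_adicCompletion K v) h𝔭 h𝔮 hne hm
    (hfin 𝔮 h𝔮) h2 hγ S hv₀ hv₀S

end Route

end Summit.BirchSwinnertonDyer.BirchSwinnertonDyer.Theorems.UniversalToricDescentSigmaCoinvariants

end
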